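import Literature.MathematicalPhysics.QuantumFieldTheory.Balaban1983to89.B4Thm19ZeroTorus
import Literature.MathematicalPhysics.QuantumFieldTheory.Balaban1983to89.B5FromB4NN
import Literature.MathematicalPhysics.QuantumFieldTheory.Balaban1983to89.B4Ineq111ZeroNestEta

/-!
# B4 «Theorem (Proposition 2.1 of [1])» p. 573 AT `A = 0` ON THE TORUS, AS TYPED: the zero-field torus instances as a
# `B4.EtaSetting` family (`torusEtaFam`), and `B5FromB4NN.ThmDepPrintedNN` / `B4Ineq111ZeroNestEta.ThmPrintedNN` /
# `B4Ineq19ZeroBoxEta.ThmPrinted19NN` HOLD ON IT — hypothesis-free, kernel-checked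

statement-level skeleton of published theorems with citation tags; proofs where landed; nothing here is a claim about the
Yang–Mills mass gap

B4 = T. Bałaban, *Regularity and decay of lattice Green's functions*, Commun. Math. Phys. **89** (1983) 571–597
[cite: Balaban1983RegularityDecay] (journal page = PDF page + 570; held `paper:balaban1983-cmp89-regularity-decay`, pp. 2–3, 12, 14
read by this seat); B5 = T. Bałaban, *Propagators and renormalization transformations for lattice gauge theories. I*, Commun.
Math. Phys. **95** (1984) 17–40 [cite: Balaban1984PropagatorsI] (p. 35 [PDF 19], p. 39 [PDF 23] read).  Cell `lit-balaban` (Phase-2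
proof seat p38 gen 4), file F3b of the programme «[2]'s Theorem on the torus at A = 0» = census item (i) `hThm` of row B5.Prop1.2
(HOME `ROWS-B5.md`, owner r02): on top of F2 = `B4Thm110ZeroTorus` ((1.10) on the torus: `thm110_zero_torus`), F3a =
`B4Thm19ZeroTorus` ((1.9) on the torus: `thm19_zero_torus`) and F4a = `B5FromB4NN` (the floored hypothesis `ThmDepPrintedNN` and
the edge `firstOrderGp_of_B4NN`).

## WHAT IS PRINTED (verbatim)

* B4 p. 572 [PDF 2]: «We consider a lattice ηZ^d … with η = L^{−k} … Another common case is to consider operators on subsets of a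
  torus T_η which we identify with a rectangular parallelepiped in ηZ^d with periodic conditions. … G_k(Ω, A) =
  (−Δ^{η,N}_{A,Ω} + m² + aP_k(A))^{−1} (1.6)»; p. 573 [PDF 3]: «−Δ^{η,N}_{A,Ω} + aP_k(A) ≥ γ₀I. (1.8) … **Theorem** (Proposition 2.1
  of [1]). For α < 1 there exist positive constants δ₀, c₀, R₀ independent of A, k, Ω and depending on d, M only, c₀ on α also,
  such that for e sufficiently small and for an arbitrary function f : Ω → R^N, we have
  |x − x′|^{−α}|U(A(Γ_{x,x′}))(D^η_{A,μ}G_k(Ω, A)f)(x′) − (D^η_{A,μ}G_k(Ω, A)f)(x)| ≤ c₀exp(−δ₀ dist({x, x′}, supp f))‖f‖_∞ (1.9)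
  for x, x′ ∈ Ω, and satisfying the condition dist({x, x′}, Ω^c) ≥ R₀. Similarly |(D^η_{A,μ}G_k(Ω, A)f)(x)|, |(G_k(Ω, A)f)(x)| ≤
  c₀exp(−δ₀ dist(x, supp f))‖f‖_∞ (1.10) for x ∈ Ω, dist(x, Ω^c) ≥ R₀. If Ω ⊂ Ω₀, then for δG_k(Ω, Ω₀, A) … (1.11) we have the
  inequalities … with the additional factor … (1.12) … For some simple sets Ω, e.g. for rectangular parallelepipeds, the
  inequalities hold without any restrictions on the points x, x′, i.e. for all x, x′ ∈ Ω.»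
* B5 p. 35 [PDF 19]: «The operators G′_k were investigated in paper [2].»; p. 39 [PDF 23]: «In paper [2] we have proved all the
  necessary properties of G′, except the second order inequalities … We use Lemma 2.4 of that paper and the equality (2.34) with □
  replaced by the whole torus.»

## WHAT THIS FILE CERTIFIES (kernel-checked, zero `sorry`)

* §1 `infT` / `infT2` / `infTS` — `dist_T(x, supp f)`, `dist_T({x,x′}, supp f)`, `dist_T(supp f, supp f′)` on the fine torus (sup
  torus metric `B5Ineq137Torus.T`, lattice units; `diamT` for an empty support, with the lower-bound lemmas `le_infT`/`le_infT2` a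
  cube dictionary needs) for `R^N`-valued sources (`supp f = ⋃_n supp f_n`); `cw` (an operator acting
  componentwise on an `R^N`-valued source, the value `((Mf_n)(x))_n ∈ R^N`) with the sup-norm bookkeeping `abs_apply_le_norm`,
  `abs_le_norm_cw`, `norm_cw_le`, `mul_norm_cw_sub_le`; `pairOps` (the four operators of Corollary 2.3).
* §2 **`torusEtaFam d L a m² : TorusEtaIdx d L → B4.EtaSetting`** — THE ZERO-FIELD TORUS INSTANCES of the Theorem for Bałaban's
  concrete scalar tower `B1RG242Torus.tower`: member `(P, e)` = the TOP level `k = K` of the volume `P = (d, L, m, K)` (`K ≥ 1`),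
  i.e. B4's `G_k(T_η, 0)` with `η = ε = L^{−K}`, UNIT blocks, on the torus of `2L^m` unit blocks per direction, acting
  componentwise on `R^N`-valued sources with `N = d` (the case B5 consumes: vector fields, G′ componentwise — the `Loc` of the
  G′-setting of record `B5GpSettingTorus.gpSetting`); every B4 torus instance `(k, T_η)` at `A = 0` is such a top level.  Fields =
  the printed quantities (dictionary below); unfolding lemmas `torusEtaFam_lhs19` / `_val` / `_dist`.
* §3 **`thmDepPrintedNN_torusEtaFam`**: `B5FromB4NN.ThmDepPrintedNN (torusEtaFam d L a m²)` for `d ≥ 1`, odd `L > 1`, `a > 0`,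
  `m² ≥ 0` — (1.9) from `thm19_zero_torus`, (1.10) from `thm110_zero_torus` (both componentwise, then the sup over components),
  (1.11)–(1.12) vacuous (`Ω = Ω₀ = T_η`, `δG = 0`); `ineq19_110_torusEtaFam` (the (1.9)–(1.10) conjunct for EVERY member, one `δ₀`
  for all `0 ≤ α < 1`); BY NAME on the same family: **`thmPrintedNN_torusEtaFam : B4Ineq111ZeroNestEta.ThmPrintedNN
  (torusEtaFam …)`** (b04's leaf `B4.ThmPrinted` restricted to `0 ≤ α`, the shape the nested-box family
  `B4Ineq111ZeroNestEta.thmPrintedNN_nestFam` discharges) and `thmPrinted19NN_torusEtaFam : B4Ineq19ZeroBoxEta.ThmPrinted19NN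
  (torusEtaFam …)`.

## DICTIONARY (member `i = (P, e)`, `k := P.K`, `ε = L^{−K} = η`; printed ↦ Lean)

`Ω = Ω₀ = T_η ↦ Site P 0` (all of it); `x, x′ ↦ x x' : Site P 0`; `f : Ω → R^N ↦ f : Fin d → Site P 0 → ℝ` (`N = d` components
`f n`; `A = 0`, `U ≡ 1`, the operators act componentwise: `cw`); `G_k(Ω,A) ↦ (tower P a m²).G K`; `D^η_{A,μ} ↦
B5Display136Torus.deriv P 0 ε μ` (forward difference quotient); `|·|` on `R^N ↦` the sup norm `‖·‖` of `Fin d → ℝ` (the Euclidean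
one of the print lies between this and `√N` times it); `|x − x′| ↦ ε·T₀(x,x′)` (`pdist`; sup torus metric — the Euclidean one lies
between this and `√d` times it); `supp f ↦ {z | ∃ n, f n z ≠ 0}`; `dist(x, supp f) ↦ ε·infT`, `dist({x,x′}, supp f) ↦ ε·infT2`,
`dist(supp f, supp f′) ↦ ε·infTS` (an empty support at distance `diamT`, the largest fine distance); `dist(·, Ωᶜ) ↦ 0` (`Ωᶜ = ∅`; these enter only through `rect ∨ R₀ ≤ bdist` and the factor
(1.12) of the vanishing `δG` clauses); `‖f‖_∞ ↦ ‖f‖` (sup over components and sites); `‖f‖₂ ↦ (ε^dΣ_nΣ_x f_n(x)²)^{1/2}`;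
`⟨f, Mf′⟩ ↦ ε^d·Σ_n f_n ⬝ᵥ (M *ᵥ f′_n)`, `D^{η*}_ν ↦ (deriv ν)ᵀ` (the `⟨·,·⟩_η`-adjoint, constant weight `η^d`); (1.8)'s operator
`−Δ^η + aP_k ↦ hOp P 0 ε 0 + α_K•(Q*_KQ_K)` (`α_K = a_K`, `L^Kε = 1`), componentwise; `regular`, `bigBlocks`, `rect ↦ True` (see
HONEST SCOPE).

## HONEST SCOPE / NOT-CERTIFIED

(i) `regular := True`: `A = 0` satisfies (1.7).  `rect := True`: the torus is the periodic rectangular parallelepiped of p. 572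
and the bounds are proved with NO restriction on `x, x′` (the Theorem's last sentence); `bigBlocks := True`: the conclusions are
proved for EVERY torus of the series, so the standing hypothesis «Ω a union of big blocks» is not needed (p. 584: «valid for an
arbitrary rectangular parallelepiped □ built of unit blocks»).  (ii) The charge `e` is carried by the index and is idle (`A = 0`);
`e₁ := 1`, `R₀ := 1` are idle witnesses.  (iii) `0 ≤ α < 1` ONLY: `B5FromB4.ThmDepPrinted (torusEtaFam …)` — the floor-less
typing — is NOT claimed; its `α < 0` instances are false on this family (unbounded Hölder weight on large tori; box analogue
`B4Thm19ZeroBoxNegAlpha`).  (iv) `m² ≥ 0` is a parameter of the family (the certified constants are allowed to depend on it; B5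
uses `m² = 0`).  (v) Lower tower levels `k < K` are not members: they are top levels of other volumes up to the rescaling
`ε ↦ L^{K−k}ε`, which is not formalised here.  (vi) (1.11)–(1.12) hold only vacuously (`Ω = Ω₀`); general `Ω ⊂ Ω₀`, `A ≠ 0`, and
`N ≠ d` are not covered (at `A = 0` every `N` is the same componentwise statement; `N = d` is the one B5 reads).  (vii) `lower18`
is recorded, not proved here ((1.8) is row B4.Claim18; cf. `B5Ineq1101QGQTorus`).  (viii) The norm on `R^N` is the sup norm.
-/

namespace Literature.MathematicalPhysics.QuantumFieldTheory.Balaban1983to89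

namespace B4ThmZeroTorusEta

open Matrix B1RG242Torus B5Display136Torus B5Ineq137Torus
open B4Thm110ZeroTorus B4Thm19ZeroTorus B5FromB4NN

noncomputable section

/-! ## §1 Distances to a support on the fine torus; componentwise action; the four paired operators of Corollary 2.3 -/

section Support

variable (P : Params)

variable {N : ℕ}

/-- **The largest fine sup torus distance** `max_{x,z} |x − z|_T` (lattice units) — the value given to `dist_T(x, ∅)` below, so
that «supp f ⊂ Δ̃(y′)» bounds `dist(x, supp f)` from below by the distance of the cubes ALSO for `f = 0` (the reading the B5
dictionary `B5FromB4.Dict.geom1/geom2` needs; for (1.9)–(1.10) themselves any value is harmless at `f = 0`, both sides vanishing).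
[cite: Balaban1983RegularityDecay, (1.9)–(1.10) p.573 («dist(x, supp f)»); Balaban1984PropagatorsI, (1.110) p.35 («supp J ⊂ Δ̃(y′)»);
bookkeeping] -/
def diamT : ℝ :=
  (Finset.univ : Finset (Site P 0 × Site P 0)).sup' ⟨(default, default), Finset.mem_univ _⟩ (fun p => T P 0 p.1 p.2)

/-- `|x − z|_T ≤ diam_T`. [cite: Balaban1983RegularityDecay, (1.10) p.573; bookkeeping] -/
theorem T_le_diamT (x z : Site P 0) : T P 0 x z ≤ diamT P :=
  Finset.le_sup' (fun p : Site P 0 × Site P 0 => T P 0 p.1 p.2) (Finset.mem_univ (x, z))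

/-- `diam_T ≥ 0`. [cite: Balaban1983RegularityDecay, (1.10) p.573; bookkeeping] -/
theorem diamT_nonneg : 0 ≤ diamT P := (T_nonneg P 0 default default).trans (T_le_diamT P default default)

/-- `dist_T(x, supp f)` for an `R^N`-valued source `f = (f_n)` (`supp f = ⋃_n supp f_n`): the least fine sup torus distance
(lattice units) from `x` to the support, `diam_T` when `f = 0` (`= min(diam_T, inf_{z ∈ supp f}|x − z|_T)`; the harmless reading of
`dist(x, ∅)`: then both sides of (1.9)–(1.10) vanish). [cite: Balaban1983RegularityDecay, (1.9)–(1.10) p.573 («dist(x, supp f)»,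
«f : Ω → R^N»)] -/
def infT (x : Site P 0) (f : Fin N → Site P 0 → ℝ) : ℝ :=
  sInf (insert (diamT P) ((fun z => T P 0 x z) '' {z | ∃ n, f n z ≠ 0}))

/-- The set whose infimum is `dist_T(x, supp f)` is bounded below (by `0`). [folklore] -/
private theorem infT_bddBelow (x : Site P 0) (f : Fin N → Site P 0 → ℝ) :
    BddBelow (insert (diamT P) ((fun z => T P 0 x z) '' {z | ∃ n, f n z ≠ 0})) :=
  ⟨0, fun t ht => by
    rcases Set.mem_insert_iff.mp ht with rfl | ⟨z, _, rfl⟩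
    · exact diamT_nonneg P
    · exact T_nonneg P 0 x z⟩

/-- `dist_T(x, supp f) ≥ 0`. [cite: Balaban1983RegularityDecay, (1.10) p.573; bookkeeping] -/
theorem infT_nonneg (x : Site P 0) (f : Fin N → Site P 0 → ℝ) : 0 ≤ infT P x f :=
  le_csInf (Set.insert_nonempty _ _) fun t ht => by
    rcases Set.mem_insert_iff.mp ht with rfl | ⟨z, _, rfl⟩
    · exact diamT_nonneg P
    · exact T_nonneg P 0 x z

/-- `dist_T(x, supp f) ≤ |x − z|_T` for `z ∈ supp f_n`. [cite: Balaban1983RegularityDecay, (1.10) p.573; bookkeeping] -/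
theorem infT_le (x : Site P 0) {f : Fin N → Site P 0 → ℝ} {n : Fin N} {z : Site P 0} (hz : f n z ≠ 0) :
    infT P x f ≤ T P 0 x z :=
  csInf_le (infT_bddBelow P x f) (Set.mem_insert_of_mem _ ⟨z, ⟨n, hz⟩, rfl⟩)

/-- `dist_T(x, supp f) ≤ diam_T`. [cite: Balaban1983RegularityDecay, (1.10) p.573; bookkeeping] -/
theorem infT_le_diamT (x : Site P 0) (f : Fin N → Site P 0 → ℝ) : infT P x f ≤ diamT P :=
  csInf_le (infT_bddBelow P x f) (Set.mem_insert _ _)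

/-- LOWER BOUND for `dist_T(x, supp f)`: a number `b ≤ diam_T` below every `|x − z|_T`, `z ∈ supp f`, is below `dist_T(x, supp f)`
(how «supp J ⊂ Δ̃(y′)», `x ∈ Δ̃(y)` give `dist(x, supp J) ≥ |y − y′| − c`). [cite: Balaban1983RegularityDecay, (1.10) p.573;
Balaban1984PropagatorsI, (1.110) p.35; bookkeeping] -/
theorem le_infT (x : Site P 0) (f : Fin N → Site P 0 → ℝ) {b : ℝ} (hb : b ≤ diamT P)
    (h : ∀ (n : Fin N) (z : Site P 0), f n z ≠ 0 → b ≤ T P 0 x z) : b ≤ infT P x f :=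
  le_csInf (Set.insert_nonempty _ _) fun t ht => by
    rcases Set.mem_insert_iff.mp ht with rfl | ⟨z, ⟨n, hz⟩, rfl⟩
    · exact hb
    · exact h n z hz

/-- `dist_T({x, x′}, supp f) = min(dist_T(x, supp f), dist_T(x′, supp f))`. [cite: Balaban1983RegularityDecay, (1.9) p.573
(«dist({x,x′}, supp f)»)] -/
def infT2 (x x' : Site P 0) (f : Fin N → Site P 0 → ℝ) : ℝ := min (infT P x f) (infT P x' f)

/-- `dist_T({x, x′}, supp f) ≥ 0`. [cite: Balaban1983RegularityDecay, (1.9) p.573; bookkeeping] -/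
theorem infT2_nonneg (x x' : Site P 0) (f : Fin N → Site P 0 → ℝ) : 0 ≤ infT2 P x x' f :=
  le_min (infT_nonneg P x f) (infT_nonneg P x' f)

/-- LOWER BOUND for `dist_T({x, x′}, supp f)` (both points). [cite: Balaban1983RegularityDecay, (1.9) p.573; Balaban1984PropagatorsI,
(1.111) p.35; bookkeeping] -/
theorem le_infT2 (x x' : Site P 0) (f : Fin N → Site P 0 → ℝ) {b : ℝ} (hb : b ≤ diamT P)
    (h : ∀ (n : Fin N) (z : Site P 0), f n z ≠ 0 → b ≤ T P 0 x z) (h' : ∀ (n : Fin N) (z : Site P 0), f n z ≠ 0 → b ≤ T P 0 x' z) :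
    b ≤ infT2 P x x' f :=
  le_min (le_infT P x f hb h) (le_infT P x' f hb h')

/-- `dist_T(supp f, supp f′)` (`diam_T` if a support is empty). [cite: Balaban1983RegularityDecay, Corollary 2.3 p.581
(«dist(supp f, supp f′)»)] -/
def infTS (f f' : Fin N → Site P 0 → ℝ) : ℝ :=
  sInf (insert (diamT P) ((fun p : Site P 0 × Site P 0 => T P 0 p.1 p.2) '' {p | (∃ n, f n p.1 ≠ 0) ∧ ∃ n, f' n p.2 ≠ 0}))

/-- `|f_n(z)| ≤ ‖f‖_∞` (sup norm over components and sites). [cite: Balaban1983RegularityDecay, (1.9)–(1.10) p.573 («‖f‖_∞»);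
bookkeeping] -/
theorem abs_apply_le_norm (f : Fin N → Site P 0 → ℝ) (n : Fin N) (z : Site P 0) : |f n z| ≤ ‖f‖ :=
  (Real.norm_eq_abs _).symm.le.trans ((norm_le_pi_norm (f n) z).trans (norm_le_pi_norm f n))

/-- **Componentwise action** of an operator `M` on `L²` of the fine torus on an `R^N`-valued source `f = (f_n)`: the vector
`((Mf)(x))_n = ((Mf_n)(x))_n ∈ R^N` (at `A = 0`, `U ≡ 1`, the operators `G_k(Ω, 0)`, `D^η_μ` of (1.1)–(1.6) are diagonal in the
internal index). [cite: Balaban1983RegularityDecay, (1.1)–(1.6) p.572, (1.9)–(1.10) p.573 («f : Ω → R^N»)] -/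
def cw (M : Matrix (Site P 0) (Site P 0) ℝ) (f : Fin N → Site P 0 → ℝ) (x : Site P 0) : Fin N → ℝ := fun n => (M *ᵥ f n) x

/-- Unfolding `cw`. [cite: Balaban1983RegularityDecay, (1.9)–(1.10) p.573; bookkeeping] -/
@[simp] theorem cw_apply (M : Matrix (Site P 0) (Site P 0) ℝ) (f : Fin N → Site P 0 → ℝ) (x : Site P 0) (n : Fin N) :
    cw P M f x n = (M *ᵥ f n) x := rfl

/-- The zero operator acts by zero (used for `δG_k(Ω, Ω₀, 0) = 0` when `Ω = Ω₀`). [cite: Balaban1983RegularityDecay, (1.11) p.573;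
bookkeeping] -/
@[simp] theorem cw_zero (f : Fin N → Site P 0 → ℝ) (x : Site P 0) : cw P 0 f x = 0 := by
  funext n; simp [cw]

/-- `|(Mf_n)(x)| ≤ |(Mf)(x)|` (a component is below the sup norm on `R^N`). [cite: Balaban1983RegularityDecay, (1.10) p.573;
bookkeeping] -/
theorem abs_le_norm_cw (M : Matrix (Site P 0) (Site P 0) ℝ) (f : Fin N → Site P 0 → ℝ) (x : Site P 0) (n : Fin N) :
    |(M *ᵥ f n) x| ≤ ‖cw P M f x‖ :=
  (Real.norm_eq_abs _).symm.le.trans (norm_le_pi_norm (cw P M f x) n)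

/-- `|(Mf_n)(x′) − (Mf_n)(x)| ≤ |(Mf)(x′) − (Mf)(x)|` (a component of a difference is below its sup norm on `R^N`).
[cite: Balaban1983RegularityDecay, (1.9) p.573; bookkeeping] -/
theorem abs_sub_le_norm_cw_sub (M : Matrix (Site P 0) (Site P 0) ℝ) (f : Fin N → Site P 0 → ℝ) (x x' : Site P 0) (n : Fin N) :
    |(M *ᵥ f n) x' - (M *ᵥ f n) x| ≤ ‖cw P M f x' - cw P M f x‖ :=
  (Real.norm_eq_abs _).symm.le.trans (norm_le_pi_norm (cw P M f x' - cw P M f x) n)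

/-- Sup-norm bookkeeping: `w·‖v‖_∞ ≤ R` from `w·|v_n| ≤ R` for every component (`w, R ≥ 0`). [folklore] -/
private theorem mul_pi_norm_le {ι : Type} [Fintype ι] {w R : ℝ} (hw : 0 ≤ w) (hR : 0 ≤ R) (v : ι → ℝ)
    (h : ∀ n, w * |v n| ≤ R) : w * ‖v‖ ≤ R := by
  rcases hw.eq_or_lt with hw0 | hw0
  · rw [← hw0, zero_mul]; exact hR
  · rw [mul_comm, ← le_div_iff₀ hw0]
    refine (pi_norm_le_iff_of_nonneg (div_nonneg hR hw0.le)).2 fun n => ?_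
    rw [Real.norm_eq_abs, le_div_iff₀ hw0, mul_comm]; exact h n

/-- Sup-norm bookkeeping: `‖v‖_∞ ≤ R` from `|v_n| ≤ R` for every component (`R ≥ 0`). [folklore] -/
private theorem pi_norm_le_of_abs_le {ι : Type} [Fintype ι] {R : ℝ} (hR : 0 ≤ R) (v : ι → ℝ) (h : ∀ n, |v n| ≤ R) :
    ‖v‖ ≤ R :=
  (pi_norm_le_iff_of_nonneg hR).2 fun n => by rw [Real.norm_eq_abs]; exact h n

/-- `|(Mf)(x)| ≤ R` on `R^N` from the componentwise bounds `|(Mf_n)(x)| ≤ R` (`R ≥ 0`) — how the scalar estimates (1.10) of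
`B4Thm110ZeroTorus` are read for `R^N`-valued sources. [cite: Balaban1983RegularityDecay, (1.10) p.573; bookkeeping] -/
theorem norm_cw_le (M : Matrix (Site P 0) (Site P 0) ℝ) (f : Fin N → Site P 0 → ℝ) (x : Site P 0) {R : ℝ} (hR : 0 ≤ R)
    (h : ∀ n, |(M *ᵥ f n) x| ≤ R) : ‖cw P M f x‖ ≤ R :=
  pi_norm_le_of_abs_le hR _ h

/-- `w·|(Mf)(x′) − (Mf)(x)| ≤ R` on `R^N` from the componentwise bounds `w·|(Mf_n)(x′) − (Mf_n)(x)| ≤ R` (`w, R ≥ 0`) — how the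
scalar estimate (1.9) of `B4Thm19ZeroTorus` is read for `R^N`-valued sources. [cite: Balaban1983RegularityDecay, (1.9) p.573;
bookkeeping] -/
theorem mul_norm_cw_sub_le (M : Matrix (Site P 0) (Site P 0) ℝ) (f : Fin N → Site P 0 → ℝ) (x x' : Site P 0) {w R : ℝ}
    (hw : 0 ≤ w) (hR : 0 ≤ R) (h : ∀ n, w * |(M *ᵥ f n) x' - (M *ᵥ f n) x| ≤ R) :
    w * ‖cw P M f x' - cw P M f x‖ ≤ R :=
  mul_pi_norm_le hw hR _ h

/-- The four operators paired in Corollary 2.3 (`B4.EtaSetting.pair`) for a propagator `M` on the fine torus with spacing `s`: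
`M`, `∂^s_μM`, `M∂^{s*}_ν`, `∂^s_μM∂^{s*}_ν` (`∂^{s*} =` the transpose: the `⟨·,·⟩_η`-adjoint, the weight `η^d` being constant).
[cite: Balaban1983RegularityDecay, Corollary 2.3 (2.30) p.581] -/
def pairOps (s : ℝ) (M : Matrix (Site P 0) (Site P 0) ℝ) (μ ν : Fin P.d) : Fin 4 → Matrix (Site P 0) (Site P 0) ℝ :=
  ![M, deriv P 0 s μ * M, M * (deriv P 0 s ν)ᵀ, deriv P 0 s μ * M * (deriv P 0 s ν)ᵀ]

end Support

/-! ## §2 The zero-field torus instances of B4's Theorem p. 573 as `B4.EtaSetting` carriers -/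

section Family

/-- **INDEX OF THE ZERO-FIELD TORUS INSTANCES** of the Theorem p. 573 for Bałaban's concrete scalar tower in dimension `d` with
block size `L`: a volume `P = (d, L, m, K)` with `K ≥ 1` — standing for B4's instance `k = K`, `η = L^{−K} = ε`, `Ω = T_η` the torus
of `2L^m` unit blocks per direction, `A = 0` — and B4's charge `e` (irrelevant at `A = 0`; carried so that every charge occurs, as
`B5FromB4.Dict.charge` wants). [cite: Balaban1983RegularityDecay, Theorem p.573 («independent of A, k, Ω»), p.572 (η = L^{−k},
torus); index bookkeeping] -/
structure TorusEtaIdx (d L : ℕ) where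
  /-- the volume `(d, L, m, K)` -/
  P : Params
  hPd : P.d = d
  hPL : P.L = L
  /-- `k = K ≥ 1` -/
  hK : 1 ≤ P.K
  /-- B4's charge (idle at `A = 0`) -/
  e : ℝ

/-- **THE ZERO-FIELD TORUS CARRIERS OF `B4.EtaSetting`** (coefficient `a > 0` and mass `m² ≥ 0` fixed for the family).  Member
`i = (P, e)`, `k := P.K`, `ε := L^{−K}` (= B4's `η`): `Site := Site P 0` (the fine torus `T_η`), `Dir := Fin d`,
`Src := Fin d → Site P 0 → ℝ` (`f : Ω → R^N`, `N = d`, the operators acting componentwise: `cw`), `e := i.e`; `regular := True`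
(`A = 0`), `bigBlocks := True`, `rect := True` (p. 572: the torus is the periodic rectangular parallelepiped; the Theorem's last
sentence); `pdist x x′ := ε|x−x′|_T`; `sdist1 x f := ε·dist_T(x, supp f)`, `sdist2 x x′ f := ε·dist_T({x,x′}, supp f)`;
`bdist1 = bdist2 = bdistS := 0` (`Ωᶜ = ∅`); `supNorm f := ‖f‖_∞` (sup over components and sites), `l2Norm f := (ε^dΣ_n‖f_n‖²)^{1/2}`,
`ssdist := ε·dist_T(supp f, supp f′)`; `lhs19 α μ f x x′ := (ε|x−x′|_T)^{−α}|(∂^ε_μG_kf)(x′) − (∂^ε_μG_kf)(x)|` (`U(A(Γ)) = 1`, `|·|`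
the sup norm on `R^N`), `valDG μ f x := |(∂^ε_μG_kf)(x)|`, `valG f x := |(G_kf)(x)|` with `G_k = (B1RG242Torus.tower P a m²).G K =
(−Δ^ε + m² + a_KQ*_KQ_K)^{−1}` and `∂^ε_μ = B5Display136Torus.deriv P 0 ε μ`, componentwise; the `δG` fields `dlhs19`, `dvalDG`,
`dvalG`, `dpair` are the same expressions for `δG_k(Ω,Ω₀,0) = G_k − G_k = 0` (`Ω = Ω₀ = T_η`); `lower18 γ :=` the form inequality
`γΣ_n‖v_n‖² ≤ Σ_n⟨v_n, (−Δ^ε + a_KQ*_KQ_K)v_n⟩` (`−Δ^ε = hOp P 0 ε 0`; the operator of (1.8), mass excluded as printed, componentwise);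
`pair n μ ν f f′ := ε^d|Σ_m f_m ⬝ (M_n f′_m)|` for `M = G_k, ∂_μG_k, G_k∂_ν^*, ∂_μG_k∂_ν^*` (Corollary 2.3).
[cite: Balaban1983RegularityDecay, §1 (1.1)–(1.12) pp.572–573, p.572 (torus, η = L^{−k}); Balaban1984PropagatorsI p.39 («with □
replaced by the whole torus»)] -/
def torusEtaFam (d L : ℕ) (a msq : ℝ) (i : TorusEtaIdx d L) : B4.EtaSetting where
  Site := Site i.P 0
  Dir := Fin i.P.d
  Src := Fin i.P.d → Site i.P 0 → ℝ
  e := i.e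
  regular := True
  bigBlocks := True
  rect := True
  pdist := fun x x' => i.P.eps * T i.P 0 x x'
  sdist1 := fun x f => i.P.eps * infT i.P x f
  sdist2 := fun x x' f => i.P.eps * infT2 i.P x x' f
  bdist1 := fun _ => 0
  bdist2 := fun _ _ => 0
  bdistS := fun _ => 0
  supNorm := fun f => ‖f‖
  l2Norm := fun f => Real.sqrt (i.P.eps ^ i.P.d * ∑ n, f n ⬝ᵥ f n)
  ssdist := fun f f' => i.P.eps * infTS i.P f f'
  lhs19 := fun α μ f x x' => ((i.P.eps * T i.P 0 x x')⁻¹) ^ α *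
    ‖cw i.P (deriv i.P 0 i.P.eps μ * (tower i.P a msq).G i.P.K) f x' -
      cw i.P (deriv i.P 0 i.P.eps μ * (tower i.P a msq).G i.P.K) f x‖
  valDG := fun μ f x => ‖cw i.P (deriv i.P 0 i.P.eps μ * (tower i.P a msq).G i.P.K) f x‖
  valG := fun f x => ‖cw i.P ((tower i.P a msq).G i.P.K) f x‖
  dlhs19 := fun α μ f x x' => ((i.P.eps * T i.P 0 x x')⁻¹) ^ α *
    ‖cw i.P (deriv i.P 0 i.P.eps μ * ((tower i.P a msq).G i.P.K - (tower i.P a msq).G i.P.K)) f x' -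
      cw i.P (deriv i.P 0 i.P.eps μ * ((tower i.P a msq).G i.P.K - (tower i.P a msq).G i.P.K)) f x‖
  dvalDG := fun μ f x =>
    ‖cw i.P (deriv i.P 0 i.P.eps μ * ((tower i.P a msq).G i.P.K - (tower i.P a msq).G i.P.K)) f x‖
  dvalG := fun f x => ‖cw i.P ((tower i.P a msq).G i.P.K - (tower i.P a msq).G i.P.K) f x‖
  lower18 := fun γ => ∀ v : Fin i.P.d → Site i.P 0 → ℝ,
    γ * ∑ n, v n ⬝ᵥ v n ≤ ∑ n, v n ⬝ᵥ ((hOp i.P 0 i.P.eps 0 +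
      (tower i.P a msq).α i.P.K • ((tower i.P a msq).Qks i.P.K * (tower i.P a msq).Qk i.P.K)) *ᵥ v n)
  pair := fun n μ ν f f' =>
    i.P.eps ^ i.P.d * |∑ m, f m ⬝ᵥ (pairOps i.P i.P.eps ((tower i.P a msq).G i.P.K) μ ν n *ᵥ f' m)|
  dpair := fun n μ ν f f' => i.P.eps ^ i.P.d *
    |∑ m, f m ⬝ᵥ (pairOps i.P i.P.eps ((tower i.P a msq).G i.P.K - (tower i.P a msq).G i.P.K) μ ν n *ᵥ f' m)|

/-- NON-VACUITY: every volume with `K ≥ 1` and every charge index a member. [cite: Balaban1983RegularityDecay, Theorem p.573;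
non-vacuity bookkeeping] -/
theorem torusEtaIdx_nonempty (P : Params) (hK : 1 ≤ P.K) (e : ℝ) : Nonempty (TorusEtaIdx P.d P.L) :=
  ⟨{ P := P, hPd := rfl, hPL := rfl, hK := hK, e := e }⟩

/-- Concretely: `d ≥ 1`, odd `L > 1`, any `m`, any `K ≥ 1` give a member. [cite: Balaban1983RegularityDecay, p.572 («L = 2 or 3»);
non-vacuity bookkeeping] -/
theorem torusEtaIdx_nonempty' (d L m K : ℕ) (hd : 1 ≤ d) (hL : Odd L ∧ 1 < L) (hK : 1 ≤ K) (e : ℝ) :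
    Nonempty (TorusEtaIdx d L) :=
  ⟨{ P := ⟨d, L, m, K, hd, hL⟩, hPd := rfl, hPL := rfl, hK := hK, e := e }⟩

/-- Every charge occurs in the family (for `B5FromB4.Dict.charge`). [cite: Balaban1984PropagatorsI, p.39; bookkeeping] -/
theorem torusEtaFam_e (d L : ℕ) (a msq : ℝ) (i : TorusEtaIdx d L) : (torusEtaFam d L a msq i).e = i.e := rfl

/-- The printed hypotheses of the member hold (`regular`, `bigBlocks`, `rect`). [cite: Balaban1983RegularityDecay, p.572–573
(standing hypotheses), p.584; bookkeeping] -/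
theorem torusEtaFam_hyps (d L : ℕ) (a msq : ℝ) (i : TorusEtaIdx d L) :
    (torusEtaFam d L a msq i).regular ∧ (torusEtaFam d L a msq i).bigBlocks ∧ (torusEtaFam d L a msq i).rect :=
  ⟨trivial, trivial, trivial⟩

/-- Unfolding: the left-hand side of (1.9) of the member. [cite: Balaban1983RegularityDecay, (1.9) p.573; bookkeeping] -/
theorem torusEtaFam_lhs19 (d L : ℕ) (a msq : ℝ) (i : TorusEtaIdx d L) (α : ℝ) (μ : Fin i.P.d)
    (f : Fin i.P.d → Site i.P 0 → ℝ) (x x' : Site i.P 0) :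
    (torusEtaFam d L a msq i).lhs19 α μ f x x' = ((i.P.eps * T i.P 0 x x')⁻¹) ^ α *
      ‖cw i.P (deriv i.P 0 i.P.eps μ * (tower i.P a msq).G i.P.K) f x' -
        cw i.P (deriv i.P 0 i.P.eps μ * (tower i.P a msq).G i.P.K) f x‖ := rfl

/-- Unfolding: the two values of (1.10) of the member. [cite: Balaban1983RegularityDecay, (1.10) p.573; bookkeeping] -/
theorem torusEtaFam_val (d L : ℕ) (a msq : ℝ) (i : TorusEtaIdx d L) (μ : Fin i.P.d) (f : Fin i.P.d → Site i.P 0 → ℝ)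
    (x : Site i.P 0) :
    (torusEtaFam d L a msq i).valDG μ f x = ‖cw i.P (deriv i.P 0 i.P.eps μ * (tower i.P a msq).G i.P.K) f x‖ ∧
      (torusEtaFam d L a msq i).valG f x = ‖cw i.P ((tower i.P a msq).G i.P.K) f x‖ := ⟨rfl, rfl⟩

/-- Unfolding: the distances and the sup norm of the member. [cite: Balaban1983RegularityDecay, (1.9)–(1.10) p.573; bookkeeping] -/
theorem torusEtaFam_dist (d L : ℕ) (a msq : ℝ) (i : TorusEtaIdx d L) (f : Fin i.P.d → Site i.P 0 → ℝ) (x x' : Site i.P 0) :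
    (torusEtaFam d L a msq i).sdist1 x f = i.P.eps * infT i.P x f ∧
      (torusEtaFam d L a msq i).sdist2 x x' f = i.P.eps * infT2 i.P x x' f ∧
        (torusEtaFam d L a msq i).supNorm f = ‖f‖ := ⟨rfl, rfl, rfl⟩

end Family

/-! ## §3 B4's Theorem with the printed dependence and `0 ≤ α < 1` HOLDS on the torus family -/

section Typed

/-- Weakening a decay bound: larger constant, smaller rate. [folklore] -/
private theorem weaken {v c c' δ δ' t m : ℝ} (h : v ≤ c * Real.exp (-(δ * t)) * m) (hc : c ≤ c') (hc' : 0 ≤ c')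
    (hδ : δ' ≤ δ) (ht : 0 ≤ t) (hm : 0 ≤ m) : v ≤ c' * Real.exp (-(δ' * t)) * m := by
  refine h.trans (mul_le_mul (mul_le_mul hc (Real.exp_le_exp.mpr ?_) (Real.exp_pos _).le hc') le_rfl hm
    (by positivity))
  nlinarith [mul_le_mul_of_nonneg_right hδ ht]

/-- **B4'S THEOREM P. 573 AT `A = 0` ON THE TORUS, AS TYPED (printed dependence, `0 ≤ α < 1`), HYPOTHESIS-FREE:
`B5FromB4NN.ThmDepPrintedNN (torusEtaFam d L a m²)`** for `d ≥ 1`, odd `L > 1`, `a > 0`, `m² ≥ 0` — there are `δ₀ > 0`, `R₀ = 1`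
and for every `0 ≤ α < 1` constants `c₀(α) > 0`, `e₁ = 1` such that every member satisfies `Ineq19_110 ∧ Ineq111_112`:
(1.9) from `B4Thm19ZeroTorus.thm19_zero_torus` component by component with `F = ‖f‖_∞`, `D = dist_T({x,x′}, supp f)` (at `x = x′`
the left side vanishes), then the sup over the components; (1.10) from `B4Thm110ZeroTorus.thm110_zero_torus` likewise (rates
merged by `min`, constants by `max`); (1.11)–(1.12) vacuous (`Ω = Ω₀`, `δG = 0`). [cite: Balaban1983RegularityDecay, Theorem
(1.9)–(1.12) p.573 («For some simple sets Ω, e.g. for rectangular parallelepipeds, the inequalities hold without any restrictions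
on the points x, x′»), (2.34)–(2.39) pp.582–584, p.572 (torus); Balaban1984PropagatorsI p.39] -/
theorem thmDepPrintedNN_torusEtaFam (d L : ℕ) (hd : 1 ≤ d) (hL : Odd L ∧ 1 < L) {a : ℝ} (ha : 0 < a) {msq : ℝ}
    (hmsq : 0 ≤ msq) : ThmDepPrintedNN (torusEtaFam d L a msq) := by
  obtain ⟨δ₁, c₁, hδ₁, hc₁, H10⟩ := thm110_zero_torus d L hd hL ha hmsq
  obtain ⟨δ₂, hδ₂, H9⟩ := thm19_zero_torus d L hd hL ha hmsq
  refine ⟨min δ₁ δ₂, 1, lt_min hδ₁ hδ₂, one_pos, fun α hα0 hα1 => ?_⟩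
  obtain ⟨c₂, hc₂, H9α⟩ := H9 hα0 hα1
  have hc0 : 0 ≤ max c₁ c₂ := hc₁.le.trans (le_max_left _ _)
  refine ⟨max c₁ c₂, 1, lt_max_of_lt_left hc₁, one_pos, fun i _ _ _ _ => ⟨⟨?_, ?_⟩, ?_, ?_⟩⟩
  · -- (1.9), componentwise
    intro μ f x x' _
    obtain ⟨P, hPd, hPL, hK, e⟩ := i
    change Fin P.d at μ
    change Fin P.d → Site P 0 → ℝ at f
    change Site P 0 at x x'
    show ((P.eps * T P 0 x x')⁻¹) ^ α *
        ‖cw P (deriv P 0 P.eps μ * (tower P a msq).G P.K) f x' - cw P (deriv P 0 P.eps μ * (tower P a msq).G P.K) f x‖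
      ≤ max c₁ c₂ * Real.exp (-(min δ₁ δ₂ * (P.eps * infT2 P x x' f))) * ‖f‖
    by_cases hx : x' = x
    · subst hx
      rw [sub_self, norm_zero, mul_zero]
      positivity
    · have hD0 : 0 ≤ infT2 P x x' f := infT2_nonneg P x x' f
      have hR : 0 ≤ max c₁ c₂ * Real.exp (-(min δ₁ δ₂ * (P.eps * infT2 P x x' f))) * ‖f‖ := by positivity
      refine mul_norm_cw_sub_le P _ f x x'
        (Real.rpow_nonneg (inv_nonneg.mpr (mul_nonneg P.eps_pos.le (T_nonneg P 0 x x'))) α) hR fun n => ?_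
      have h := H9α P hPd hPL P.K hK le_rfl μ x x' hx (f n) ‖f‖ (infT2 P x x' f) (fun z => abs_apply_le_norm P f n z)
        hD0 (fun z hz => (min_le_left _ _).trans (infT_le P x hz)) (fun z hz => (min_le_right _ _).trans (infT_le P x' hz))
      exact weaken h (le_max_right _ _) hc0 (min_le_right _ _) (mul_nonneg P.eps_pos.le hD0) (norm_nonneg f)
  · -- (1.10), componentwise
    intro μ f x _
    obtain ⟨P, hPd, hPL, hK, e⟩ := i
    change Fin P.d at μ
    change Fin P.d → Site P 0 → ℝ at f
    change Site P 0 at x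
    show ‖cw P (deriv P 0 P.eps μ * (tower P a msq).G P.K) f x‖
        ≤ max c₁ c₂ * Real.exp (-(min δ₁ δ₂ * (P.eps * infT P x f))) * ‖f‖ ∧
      ‖cw P ((tower P a msq).G P.K) f x‖ ≤ max c₁ c₂ * Real.exp (-(min δ₁ δ₂ * (P.eps * infT P x f))) * ‖f‖
    have hD0 : 0 ≤ infT P x f := infT_nonneg P x f
    have ht : 0 ≤ P.eps * infT P x f := mul_nonneg P.eps_pos.le hD0
    have hR : 0 ≤ max c₁ c₂ * Real.exp (-(min δ₁ δ₂ * (P.eps * infT P x f))) * ‖f‖ := by positivity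
    have h := fun n : Fin P.d => H10 P hPd hPL P.K hK le_rfl x (f n) ‖f‖ (infT P x f)
      (fun z => abs_apply_le_norm P f n z) hD0 (fun z hz => infT_le P x hz)
    exact ⟨norm_cw_le P _ f x hR fun n => weaken ((h n).2 μ) (le_max_left _ _) hc0 (min_le_left _ _) ht (norm_nonneg f),
      norm_cw_le P _ f x hR fun n => weaken (h n).1 (le_max_left _ _) hc0 (min_le_left _ _) ht (norm_nonneg f)⟩
  · -- (1.11)–(1.12), Hölder clause: δG = 0
    intro μ f x x' _
    obtain ⟨P, hPd, hPL, hK, e⟩ := i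
    change Fin P.d at μ
    change Fin P.d → Site P 0 → ℝ at f
    change Site P 0 at x x'
    show ((P.eps * T P 0 x x')⁻¹) ^ α *
        ‖cw P (deriv P 0 P.eps μ * ((tower P a msq).G P.K - (tower P a msq).G P.K)) f x' -
          cw P (deriv P 0 P.eps μ * ((tower P a msq).G P.K - (tower P a msq).G P.K)) f x‖
      ≤ max c₁ c₂ * Real.exp (-(min δ₁ δ₂ * (P.eps * infT2 P x x' f))) *
          Real.exp (-(min δ₁ δ₂ * 0 + min δ₁ δ₂ * 0)) * ‖f‖
    simp only [sub_self, mul_zero, cw_zero, norm_zero]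
    positivity
  · -- (1.11)–(1.12), value clauses: δG = 0
    intro μ f x _
    obtain ⟨P, hPd, hPL, hK, e⟩ := i
    change Fin P.d at μ
    change Fin P.d → Site P 0 → ℝ at f
    change Site P 0 at x
    show ‖cw P (deriv P 0 P.eps μ * ((tower P a msq).G P.K - (tower P a msq).G P.K)) f x‖
        ≤ max c₁ c₂ * Real.exp (-(min δ₁ δ₂ * (P.eps * infT P x f))) *
          Real.exp (-(min δ₁ δ₂ * 0 + min δ₁ δ₂ * 0)) * ‖f‖ ∧
      ‖cw P ((tower P a msq).G P.K - (tower P a msq).G P.K) f x‖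
        ≤ max c₁ c₂ * Real.exp (-(min δ₁ δ₂ * (P.eps * infT P x f))) *
          Real.exp (-(min δ₁ δ₂ * 0 + min δ₁ δ₂ * 0)) * ‖f‖
    simp only [sub_self, mul_zero, cw_zero, norm_zero]
    constructor <;> positivity

/-- The (1.9)–(1.10) conjunct alone, for EVERY member (the hypotheses `regular`, `bigBlocks`, the charge window being idle), in
the shape the edge `B5FromB4NN.firstOrderGp_of_B4NN` reads through a dictionary: one rate `δ₀` for all `0 ≤ α < 1`, `R₀ = 1`
idle (`rect` holds). [cite: Balaban1983RegularityDecay, Theorem (1.9)–(1.10) p.573, p.572 (torus)] -/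
theorem ineq19_110_torusEtaFam (d L : ℕ) (hd : 1 ≤ d) (hL : Odd L ∧ 1 < L) {a : ℝ} (ha : 0 < a) {msq : ℝ}
    (hmsq : 0 ≤ msq) :
    ∃ δ₀ : ℝ, 0 < δ₀ ∧ ∀ α : ℝ, 0 ≤ α → α < 1 → ∃ c₀ : ℝ, 0 < c₀ ∧
      ∀ i : TorusEtaIdx d L, B4.Ineq19_110 (torusEtaFam d L a msq i) α δ₀ c₀ 1 := by
  obtain ⟨δ₀, R₀, hδ₀, -, H⟩ := thmDepPrintedNN_torusEtaFam d L hd hL ha hmsq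
  refine ⟨δ₀, hδ₀, fun α hα0 hα1 => ?_⟩
  obtain ⟨c₀, e₁, hc₀, he₁, H'⟩ := H α hα0 hα1
  refine ⟨c₀, hc₀, fun i => ?_⟩
  -- the bounds do not see the charge: transport along `e ↦ e₁`
  have h := (H' { i with e := e₁ } trivial trivial he₁ le_rfl).1
  obtain ⟨P, hPd, hPL, hK, e⟩ := i
  exact ⟨fun μ f x x' _ => h.1 μ f x x' (Or.inl trivial), fun μ f x _ => h.2 μ f x (Or.inl trivial)⟩

/-- **BY NAME: b04's leaf `B4.ThmPrinted` restricted to `0 ≤ α` — `B4Ineq111ZeroNestEta.ThmPrintedNN` — HOLDS ON THE TORUS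
FAMILY** (the shape the nested-box zero-field family discharges in `B4Ineq111ZeroNestEta.thmPrintedNN_nestFam`; coarser quantifier
order `∀ α ∃ (δ₀, c₀, R₀, e₁)`). [cite: Balaban1983RegularityDecay, Theorem (1.9)–(1.12) p.573, p.572 (torus)] -/
theorem thmPrintedNN_torusEtaFam (d L : ℕ) (hd : 1 ≤ d) (hL : Odd L ∧ 1 < L) {a : ℝ} (ha : 0 < a) {msq : ℝ}
    (hmsq : 0 ≤ msq) : B4Ineq111ZeroNestEta.ThmPrintedNN (torusEtaFam d L a msq) :=
  thmPrintedNN_of_depNN _ (thmDepPrintedNN_torusEtaFam d L hd hL ha hmsq)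

/-- BY NAME: the (1.9)–(1.10) half `B4Ineq19ZeroBoxEta.ThmPrinted19NN` holds on the torus family.
[cite: Balaban1983RegularityDecay, Theorem (1.9)–(1.10) p.573, p.572 (torus)] -/
theorem thmPrinted19NN_torusEtaFam (d L : ℕ) (hd : 1 ≤ d) (hL : Odd L ∧ 1 < L) {a : ℝ} (ha : 0 < a) {msq : ℝ}
    (hmsq : 0 ≤ msq) : B4Ineq19ZeroBoxEta.ThmPrinted19NN (torusEtaFam d L a msq) :=
  B4Ineq111ZeroNestEta.thmPrinted19NN_of_thmPrintedNN _ (thmPrintedNN_torusEtaFam d L hd hL ha hmsq)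

/-- A concrete instance, for the record: `d = 3`, `L = 3`, `a = 1`, `m² = 0`. [cite: Balaban1983RegularityDecay, Theorem p.573,
p.572 («L = 2 or 3»); instance bookkeeping] -/
example : ThmDepPrintedNN (torusEtaFam 3 3 1 0) :=
  thmDepPrintedNN_torusEtaFam 3 3 (by norm_num) ⟨⟨1, by norm_num⟩, by norm_num⟩ one_pos le_rfl

end Typed

end

end B4ThmZeroTorusEta

end Literature.MathematicalPhysics.QuantumFieldTheory.Balaban1983to89
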